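import Summits.QuantumFields.GaugeBoot.OneOverNHierarchy
import HarnessLib

/-!
# The `1/N` expansion of Wilson loop expectations in strongly coupled `SO(N)` lattice gauge theory, to all orders (gauge-boot, ADDENDUM 30)

HONEST FRAMING (cell `pub-gaugeboot`, page 1 of every file): the venture produces certified bounds
on lattice expectations at stated coupling, gauge group, dimension and torus size; NOT a mass gap,
NOT a continuum limit, NOT a string tension; NOT Yang–Mills-summit-bearing (barriers
`FixedCouplingUltralocality`, `PerturbativeInvisibility`).  This file is about `SO(N)` lattice gauge theory with free boundary
condition in `ℤ^d` at STRONG coupling (`|β| ≤ β₀(d,k)`, tiny) and LARGE `N`: S. Chatterjee, Comm. Math. Phys. **366** (2019);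
S. Chatterjee and J. Jafarov, *The `1/N` expansion for `SO(N)` lattice gauge theory at strong coupling*, arXiv:1604.04777.
Nothing here concerns four-dimensional continuum Yang–Mills, a mass gap, a string tension or the cell's certified tables.

## Content

★★★ `oneOverN_expansion` — **the `1/N` expansion to all orders** (Chatterjee–Jafarov, Theorem 3.1 (ii)–(iii) and Theorem 5.1,
with the coefficients produced as limits rather than as string sums).  For `d ≥ 2` there are `β₀(d, 0) ≥ β₀(d, 1) ≥ ⋯ > 0`,
constants `C_k, L_k` and functions `F_ℓ(β, ·) : 𝒮 → ℝ` (`ℓ ≥ 0`, `F₀ = F₁ = 0`; the `k`-th coefficient of the expansion is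
`f_k := F_{k+2}`) such that for every `k ≥ 0` and `|β| ≤ β₀(d,k)`:
* `f_0(∅) = 1`, `f_k(∅) = 0` (`k ≥ 1`); `|f_k(β, s)| ≤ C_k L_k^{|s|}` on loop sequences in minimal representation;
* the RECURSION (5.2) of the source in symmetrized form:
  `|s| f_k(s) = Σ_{𝕊⁻}f_k − Σ_{𝕊⁺}f_k + βΣ_{𝔻⁻}f_k − βΣ_{𝔻⁺}f_k + |s| f_{k−1}(s) + Σ_{𝕋⁻}f_{k−1} − Σ_{𝕋⁺}f_{k−1} + Σ_{𝕄⁻}f_{k−2} − Σ_{𝕄⁺}f_{k−2}`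
  (`f_{−1} = f_{−2} = 0`; for `k = 0` this is the limiting master loop equation, Theorem 9.9 of Chatterjee 2019);
* for EVERY sequence of cubes `Λ_N = [−M_N, M_N]^d` growing faster than logarithmically (`a·log₂N ≤ M_N` eventually, for every
  `a`) and every loop sequence `s = (l₁,…,lₙ)` in minimal representation,

  `N^k · ( ⟨W_{l₁}⋯W_{lₙ}⟩_{Λ_N,N,β}/Nⁿ − f_0(s) − f_1(s)/N − ⋯ − f_{k−1}(s)/N^{k−1} ) ⟶ f_k(s)`  as `N → ∞`,

  i.e. `⟨W_{l₁}⋯W_{lₙ}⟩/Nⁿ = f_0 + f_1/N + ⋯ + f_k/N^k + o(N^{−k})` (`oneOverN_expansion_remainder`).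

METHOD (the lane's, not the source's): the remainder hierarchy `R₀ = φ/N²`, `R_{ℓ+1} = N(R_ℓ − F_ℓ)`, `F_ℓ = lim R_ℓ` of the
sibling `OneOverNHierarchy`, climbed by induction on the level: a Catalan-weighted a priori bound at depth `4k(log₂N+3)` inside
the cube (`OneOverNAPriori`), the exact linearised equation of each remainder with the twisting/merger terms of the previous
levels as source (Theorem 3.6 of Chatterjee 2019 is level two), the sourced contraction Cauchy argument (`OneOverNCauchy`), the
limit equation and uniqueness for the sourced symmetrized equation (`OneOverNOrderLimit`, ADDENDA 28–29).  The growth condition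
on the cubes is necessary in general (finite-volume effects of order `(3/4)^{depth}` against `N^{−k}`); `β₀(d,k) → 0` as
`k → ∞`, as in the source.  The identification `f_0 = Σ_X w_β(X)` (gauge–string duality) is the sibling `GaugeStringDuality`;
the string-theoretic formula for `f_k` (Theorem 3.1 (i) of the source: trajectories of genus `k/2`) is NOT claimed here.

Everything is `[folklore]` given the siblings; the statement is Chatterjee–Jafarov's main theorem (parts (ii), (iii)).
-/

noncomputable section

open Filter Topology
open Literature.Probability.LatticeModels (Site box)
open Literature.MathematicalPhysics.QuantumFieldTheory (latticeNorm)
open Literature.MathematicalPhysics.QuantumFieldTheory.Chatterjee2019LargeN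
open Literature.MathematicalPhysics.QuantumFieldTheory.Chatterjee2019LargeN.CoeffCatalanBoundProof

namespace Summit.QuantumFields.GaugeBoot

namespace StringDuality

variable {d : ℕ}

/-- The contraction regime: `K ≥ 4` and `|β| ≤ (4096 (d+1) K⁴)⁻¹` give `2/K + 1024(d−1)K⁴|β| ≤ 3/4`.
[cite: Chatterjee2019LargeN, Lemma 10.1 (choice of K and β₀)] -/
theorem contraction_regime {K β : ℝ} (hK4 : 4 ≤ K) (hβ : |β| ≤ 1 / (4096 * ((d : ℝ) + 1) * K ^ 4)) :
    2 / K + |β| * (2 * ((2 * (d - 1) : ℕ) : ℝ) * 256 * K ^ 4) ≤ 3 / 4 := by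
  have hK0 : 0 < K := by linarith
  set P : ℝ := ((2 * (d - 1) : ℕ) : ℝ) with hPdef
  have hP0 : 0 ≤ P := Nat.cast_nonneg _
  have hP : P ≤ 2 * ((d : ℝ) + 1) := by
    have h : (2 * (d - 1) : ℕ) ≤ 2 * (d + 1) := by omega
    rw [hPdef]; exact_mod_cast h
  have h1 : 2 / K ≤ 1 / 2 := by rw [div_le_iff₀ hK0]; linarith
  have h2 : |β| * (2 * P * 256 * K ^ 4) ≤ 1 / 4 := by
    calc |β| * (2 * P * 256 * K ^ 4)
        ≤ (1 / (4096 * ((d : ℝ) + 1) * K ^ 4)) * (2 * (2 * ((d : ℝ) + 1)) * 256 * K ^ 4) := by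
          apply mul_le_mul hβ _ (by positivity) (by positivity); gcongr
      _ = 1 / 4 := by field_simp; ring
  linarith

variable (d)

/-- ★★★ **The `1/N` expansion to all orders** (Chatterjee–Jafarov).  See the module docstring; `F (k+2) β` is the `k`-th
coefficient `f_k(β, ·)`, `F 0 = F 1 = 0`.
[cite: ChatterjeeJafarov2016OneOverN, Theorem 3.1 (ii), (iii), Theorem 5.1 (recursion (5.2)), Theorem 6.1; Chatterjee2019LargeN, Theorems 3.6, 9.9] -/
theorem oneOverN_expansion (hd : 2 ≤ d) :
    ∃ β₀ : ℕ → ℝ, (∀ k, 0 < β₀ k) ∧ (∀ k, β₀ (k + 1) ≤ β₀ k) ∧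
    ∃ C L : ℕ → ℝ, ∃ F : ℕ → ℝ → LoopSeq d → ℝ,
      (∀ (β : ℝ) (u : LoopSeq d), F 0 β u = 0) ∧ (∀ (β : ℝ) (u : LoopSeq d), F 1 β u = 0) ∧
      ∀ (k : ℕ) (β : ℝ), |β| ≤ β₀ k →
        F (k + 2) β [] = (if k = 0 then 1 else 0) ∧
        (∀ s : LoopSeq d, IsLoopSeq s → |F (k + 2) β s| ≤ C k * L k ^ s.len) ∧
        (∀ s : LoopSeq d, IsLoopSeq s → s ≠ [] →
          (s.len : ℝ) * F (k + 2) β s -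
              ((∑ o : InvIdx s, F (k + 2) β (s.negSplitAt o)) - (∑ o : SameIdx s, F (k + 2) β (s.posSplitAt o))
                + β * (∑ o : DeformIdx s, F (k + 2) β (s.negDeformAt o))
                - β * (∑ o : DeformIdx s, F (k + 2) β (s.posDeformAt o))) =
            (s.len : ℝ) * F (k + 1) β s
              + ((∑ o : SameIdx s, F (k + 1) β (s.negTwistAt o)) - ∑ o : InvIdx s, F (k + 1) β (s.posTwistAt o))
              + ((∑ o : MergeIdx s, F k β (s.negMergeAt o)) - ∑ o : MergeIdx s, F k β (s.posMergeAt o))) ∧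
        (∀ M : ℕ → ℕ, (∀ a : ℕ, ∀ᶠ N : ℕ in atTop, a * Nat.log 2 N ≤ M N) → ∀ s : LoopSeq d, IsLoopSeq s →
          Tendsto (fun N : ℕ => (N : ℝ) ^ k *
            (phi N β (box d (M N)) s - ∑ i ∈ Finset.range k, F (i + 2) β s / (N : ℝ) ^ i)) atTop (𝓝 (F (k + 2) β s))) := by
  -- ### constants
  obtain ⟨K, hK0, hKs⟩ : ∃ K : ℕ → ℝ, K 0 = 4 ∧ ∀ j, K (j + 1) = 64 * K j ^ 2 :=
    ⟨fun j => Nat.rec (4 : ℝ) (fun _ x => 64 * x ^ 2) j, rfl, fun _ => rfl⟩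
  have hK4 : ∀ j, 4 ≤ K j := by
    intro j
    induction j with
    | zero => rw [hK0]
    | succ j ih => rw [hKs]; nlinarith
  have hKs' : ∀ j, 64 * K j ^ 2 ≤ K (j + 1) := fun j => (hKs j).ge
  set B : ℕ → ℝ := fun j => (21 : ℝ) ^ j with hBdef
  have hB0 : ∀ j, 0 ≤ B j := fun j => by positivity
  have hBs : ∀ j, 21 * B j ≤ B (j + 1) := fun j => by rw [hBdef]; simp only; rw [pow_succ]; linarith
  -- the contraction thresholds
  set βc : ℕ → ℝ := fun j => 1 / (4096 * ((d : ℝ) + 1) * K j ^ 4) with hβc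
  have hβc_pos : ∀ j, 0 < βc j := fun j => by
    have := hK4 j; rw [hβc]; positivity
  have hθ_of : ∀ (j : ℕ) (β : ℝ), |β| ≤ βc j → 2 / K j + |β| * (2 * ((2 * (d - 1) : ℕ) : ℝ) * 256 * K j ^ 4) ≤ 3 / 4 :=
    fun j β hβ => contraction_regime (hK4 j) hβ
  -- the uniqueness thresholds
  have hUex := fun j => sourced_symmetrized_unique (d := d) (M := B j) (L := 4 * K j) (hB0 j) (by linarith [hK4 j])
  choose βu hβu_pos hU using hUex
  -- `β₀`
  obtain ⟨β₀, hβ₀0, hβ₀s⟩ : ∃ β₀ : ℕ → ℝ, β₀ 0 = min (βc 0) (min (βu 0) (βc 1)) ∧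
      ∀ k, β₀ (k + 1) = min (β₀ k) (min (βc (k + 1)) (min (βu (k + 1)) (βc (k + 2)))) :=
    ⟨fun k => Nat.rec (min (βc 0) (min (βu 0) (βc 1)))
      (fun k b => min b (min (βc (k + 1)) (min (βu (k + 1)) (βc (k + 2))))) k, rfl, fun _ => rfl⟩
  have hβ₀_pos : ∀ k, 0 < β₀ k := by
    intro k
    induction k with
    | zero => rw [hβ₀0]; exact lt_min (hβc_pos 0) (lt_min (hβu_pos 0) (hβc_pos 1))
    | succ k ih => rw [hβ₀s]; exact lt_min ih (lt_min (hβc_pos _) (lt_min (hβu_pos _) (hβc_pos _)))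
  have hβ₀_anti : ∀ k, β₀ (k + 1) ≤ β₀ k := fun k => by rw [hβ₀s]; exact min_le_left _ _
  have hβ₀_le : ∀ k, β₀ k ≤ βc k ∧ β₀ k ≤ βu k ∧ β₀ k ≤ βc (k + 1) := by
    intro k
    rcases k with _ | k
    · rw [hβ₀0]
      exact ⟨min_le_left _ _, (min_le_right _ _).trans (min_le_left _ _), (min_le_right _ _).trans (min_le_right _ _)⟩
    · rw [hβ₀s]
      exact ⟨(min_le_right _ _).trans (min_le_left _ _),
        (min_le_right _ _).trans ((min_le_right _ _).trans (min_le_left _ _)),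
        (min_le_right _ _).trans ((min_le_right _ _).trans (min_le_right _ _))⟩
  -- ### the remainder hierarchy
  obtain ⟨R, hR0, hrec⟩ : ∃ R : ℝ → ℕ → Finset (Site d) → ℕ → LoopSeq d → ℝ,
      (∀ (β : ℝ) (Λ : Finset (Site d)) (N : ℕ) (u : LoopSeq d), R β 0 Λ N u = phi N β Λ u / ((max N 1 : ℕ) : ℝ) ^ 2) ∧
      (∀ (β : ℝ) (ℓ : ℕ) (Λ : Finset (Site d)) (N : ℕ) (u : LoopSeq d), R β (ℓ + 1) Λ N u =
        ((max N 1 : ℕ) : ℝ) * (R β ℓ Λ N u - limUnder atTop (fun N' : ℕ => R β ℓ (box d (N' * N')) N' u))) :=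
    ⟨fun β ℓ => Nat.rec (motive := fun _ => Finset (Site d) → ℕ → LoopSeq d → ℝ)
        (fun Λ N u => phi N β Λ u / ((max N 1 : ℕ) : ℝ) ^ 2)
        (fun _ Rℓ Λ N u => ((max N 1 : ℕ) : ℝ) * (Rℓ Λ N u - limUnder atTop (fun N' : ℕ => Rℓ (box d (N' * N')) N' u))) ℓ,
      fun _ _ _ _ => rfl, fun _ _ _ _ _ => rfl⟩
  set F : ℕ → ℝ → LoopSeq d → ℝ := fun ℓ β u => limUnder atTop (fun N : ℕ => R β ℓ (box d (N * N)) N u) with hFdef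
  have hrec' : ∀ (β : ℝ) (ℓ : ℕ) (Λ : Finset (Site d)) (N : ℕ) (u : LoopSeq d),
      R β (ℓ + 1) Λ N u = ((max N 1 : ℕ) : ℝ) * (R β ℓ Λ N u - F ℓ β u) := fun β ℓ Λ N u => hrec β ℓ Λ N u
  have hF : ∀ (β : ℝ) (ℓ : ℕ) (t : LoopSeq d), (∃ q : ℝ, Tendsto (fun N : ℕ => R β ℓ (box d (N * N)) N t) atTop (𝓝 q)) →
      Tendsto (fun N : ℕ => R β ℓ (box d (N * N)) N t) atTop (𝓝 (F ℓ β t)) := fun β ℓ t h => tendsto_nhds_limUnder h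
  refine ⟨β₀, hβ₀_pos, hβ₀_anti, fun k => B k, fun k => 4 * K k, F, ?_, ?_, ?_⟩
  · intro β u
    exact (hierarchy_base hd β (K := K 0) (B := B 0) (by linarith [hK4 0]) (by simp [hBdef]) (R β) (fun ℓ => F ℓ β)
      (hR0 β) (hrec' β) (hF β)).2.1 u
  · intro β u
    exact (hierarchy_base hd β (K := K 0) (B := B 0) (by linarith [hK4 0]) (by simp [hBdef]) (R β) (fun ℓ => F ℓ β)
      (hR0 β) (hrec' β) (hF β)).2.2.1 u
  intro k β hβk
  -- base facts at this `β`
  obtain ⟨hR2, hF0, hF1, hAP2, hAP1, hEQ0, hC10, hC00, hnil0⟩ := hierarchy_base hd β (K := K 0) (B := B 0)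
    (by linarith [hK4 0]) (by simp [hBdef]) (R β) (fun ℓ => F ℓ β) (hR0 β) (hrec' β) (hF β)
  -- ### the induction over the levels
  have main : ∀ j : ℕ, |β| ≤ β₀ j →
      (∀ (Λ : Finset (Site d)) (N : ℕ), 2 ≤ N → ∀ t : LoopSeq d, IsLoopSeq t →
        (∀ l ∈ t, ∀ e ∈ l, ∀ v : Site d,
          latticeNorm (v - DEdge.src e) ≤ ((j * (4 * (Nat.log 2 N + 3)) : ℕ) : ℝ) ∨
            latticeNorm (v - DEdge.tgt e) ≤ ((j * (4 * (Nat.log 2 N + 3)) : ℕ) : ℝ) → v ∈ Λ) →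
        |R β (j + 2) Λ N t| ≤ B j * (K j ^ t.index * catProd t)) ∧
      (∀ (Λ : Finset (Site d)) (N : ℕ), 2 ≤ N → ∀ t : LoopSeq d, IsLoopSeq t →
        (∀ l ∈ t, ∀ e ∈ l, ∀ v : Site d,
          latticeNorm (v - DEdge.src e) ≤ ((j * (4 * (Nat.log 2 N + 3)) : ℕ) : ℝ) ∨
            latticeNorm (v - DEdge.tgt e) ≤ ((j * (4 * (Nat.log 2 N + 3)) : ℕ) : ℝ) → v ∈ Λ) →
        |R β (j + 1) Λ N t| ≤ B j * (K j ^ t.index * catProd t)) ∧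
      (∀ Λ : Finset (Site d), Λ.Nonempty → ∀ N : ℕ, 2 ≤ N → ∀ t : LoopSeq d, IsLoopSeq t → t ≠ [] →
        (∀ l ∈ t, ∀ e ∈ l, ∀ v : Site d,
          latticeNorm (v - DEdge.src e) ≤ 1 ∨ latticeNorm (v - DEdge.tgt e) ≤ 1 → v ∈ Λ) →
        (t.len : ℝ) * R β (j + 2) Λ N t -
            ((∑ o : InvIdx t, R β (j + 2) Λ N (t.negSplitAt o)) - (∑ o : SameIdx t, R β (j + 2) Λ N (t.posSplitAt o))
              + β * (∑ o : DeformIdx t, R β (j + 2) Λ N (t.negDeformAt o))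
              - β * (∑ o : DeformIdx t, R β (j + 2) Λ N (t.posDeformAt o))) =
          (t.len : ℝ) * R β (j + 1) Λ N t
            + ((∑ o : SameIdx t, R β (j + 1) Λ N (t.negTwistAt o)) - ∑ o : InvIdx t, R β (j + 1) Λ N (t.posTwistAt o))
            + ((∑ o : MergeIdx t, R β j Λ N (t.negMergeAt o)) - ∑ o : MergeIdx t, R β j Λ N (t.posMergeAt o))) ∧
      (∀ M : ℕ → ℕ, (∀ b : ℕ, ∀ᶠ N : ℕ in atTop, j * (4 * (Nat.log 2 N + 3)) + b ≤ M N) → ∀ t : LoopSeq d, IsLoopSeq t →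
        Tendsto (fun N : ℕ => R β (j + 1) (box d (M N)) N t) atTop (𝓝 (F (j + 1) β t))) ∧
      (∀ M : ℕ → ℕ, (∀ b : ℕ, ∀ᶠ N : ℕ in atTop, j * (4 * (Nat.log 2 N + 3)) + b ≤ M N) → ∀ t : LoopSeq d, IsLoopSeq t →
        Tendsto (fun N : ℕ => R β j (box d (M N)) N t) atTop (𝓝 (F j β t))) ∧
      (∀ (Λ : Finset (Site d)) (N : ℕ), R β (j + 2) Λ N [] = if j = 0 then 1 else 0) ∧
      (∀ M : ℕ → ℕ, (∀ b : ℕ, ∀ᶠ N : ℕ in atTop, j * (4 * (Nat.log 2 N + 3)) + b ≤ M N) → ∀ t : LoopSeq d, IsLoopSeq t →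
        Tendsto (fun N : ℕ => R β (j + 2) (box d (M N)) N t) atTop (𝓝 (F (j + 2) β t))) ∧
      (F (j + 2) β [] = if j = 0 then 1 else 0) ∧
      (∀ t : LoopSeq d, IsLoopSeq t → |F (j + 2) β t| ≤ B j * (K j ^ t.index * catProd t)) ∧
      (∀ t : LoopSeq d, IsLoopSeq t → t ≠ [] →
        (t.len : ℝ) * F (j + 2) β t -
            ((∑ o : InvIdx t, F (j + 2) β (t.negSplitAt o)) - (∑ o : SameIdx t, F (j + 2) β (t.posSplitAt o))
              + β * (∑ o : DeformIdx t, F (j + 2) β (t.negDeformAt o)) - β * (∑ o : DeformIdx t, F (j + 2) β (t.posDeformAt o))) =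
          (t.len : ℝ) * F (j + 1) β t
            + ((∑ o : SameIdx t, F (j + 1) β (t.negTwistAt o)) - ∑ o : InvIdx t, F (j + 1) β (t.posTwistAt o))
            + ((∑ o : MergeIdx t, F j β (t.negMergeAt o)) - ∑ o : MergeIdx t, F j β (t.posMergeAt o))) := by
    intro j
    induction j with
    | zero =>
      intro hβ
      obtain ⟨hc0, hu0, -⟩ := hβ₀_le 0
      have hθ := hθ_of 0 β (hβ.trans hc0)
      have hAPQ : ∀ (Λ : Finset (Site d)) (N : ℕ), 2 ≤ N → ∀ t : LoopSeq d, IsLoopSeq t →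
          (∀ l ∈ t, ∀ e ∈ l, ∀ v : Site d,
            latticeNorm (v - DEdge.src e) ≤ ((0 * (4 * (Nat.log 2 N + 3)) : ℕ) : ℝ) ∨
              latticeNorm (v - DEdge.tgt e) ≤ ((0 * (4 * (Nat.log 2 N + 3)) : ℕ) : ℝ) → v ∈ Λ) →
          |R β (0 + 2) Λ N t| ≤ B 0 * (K 0 ^ t.index * catProd t) := fun Λ N hN t ht _ => hAP2 Λ N hN t ht
      have hC1 : ∀ M : ℕ → ℕ, (∀ b : ℕ, ∀ᶠ N : ℕ in atTop, 0 * (4 * (Nat.log 2 N + 3)) + b ≤ M N) →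
          ∀ t : LoopSeq d, IsLoopSeq t → Tendsto (fun N : ℕ => R β (0 + 1) (box d (M N)) N t) atTop (𝓝 (F (0 + 1) β t)) :=
        fun M _ t _ => hC10 M t
      have hC0 : ∀ M : ℕ → ℕ, (∀ b : ℕ, ∀ᶠ N : ℕ in atTop, 0 * (4 * (Nat.log 2 N + 3)) + b ≤ M N) →
          ∀ t : LoopSeq d, IsLoopSeq t → Tendsto (fun N : ℕ => R β 0 (box d (M N)) N t) atTop (𝓝 (F 0 β t)) :=
        fun M _ t _ => hC00 M t
      have hnil : ∀ (Λ : Finset (Site d)) (N : ℕ), R β (0 + 2) Λ N [] = if (0 : ℕ) = 0 then 1 else 0 := by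
        intro Λ N; rw [if_pos rfl]; exact hnil0 Λ N
      have hout := hierarchy_out (β := β) (K := K) (B := B) 0 (hK4 0) (hB0 0) hθ (hU 0 β (hβ.trans hu0)) (R β)
        (fun ℓ => F ℓ β) (hF β) _ hnil hAPQ hEQ0 hC1 hC0
      exact ⟨hAPQ, fun Λ N hN t ht _ => hAP1 Λ N hN t ht, hEQ0, hC1, hC0, hnil, hout⟩
    | succ j ih =>
      intro hβ
      have hβj : |β| ≤ β₀ j := hβ.trans (hβ₀_anti j)
      obtain ⟨hAPQ, hAPP, hEQ, hC1, hC0, hnil, hCQ, hFnil, hFB, hFEQ⟩ := ih hβj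
      obtain ⟨hc1, hu1, -⟩ := hβ₀_le (j + 1)
      have hθ' := hθ_of (j + 1) β (hβ.trans hc1)
      obtain ⟨hAPQ', hAPP', hEQ', hnil'⟩ := hierarchy_succ (β := β) (K := K) (B := B) j (hK4 j) (hKs' j) (hB0 j) (hBs j)
        hθ' (R β) (fun ℓ => F ℓ β) (hrec' β) _ hnil hFnil hAPQ hAPP hFB hEQ hFEQ
      have hnil'' : ∀ (Λ : Finset (Site d)) (N : ℕ), R β (j + 1 + 2) Λ N [] = if j + 1 = 0 then 1 else 0 := by
        intro Λ N; rw [if_neg (Nat.succ_ne_zero j)]; exact hnil' Λ N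
      have hC1' : ∀ M : ℕ → ℕ, (∀ b : ℕ, ∀ᶠ N : ℕ in atTop, (j + 1) * (4 * (Nat.log 2 N + 3)) + b ≤ M N) →
          ∀ t : LoopSeq d, IsLoopSeq t →
            Tendsto (fun N : ℕ => R β (j + 1 + 1) (box d (M N)) N t) atTop (𝓝 (F (j + 1 + 1) β t)) :=
        fun M hM t ht => hCQ M (adm_mono hM) t ht
      have hC0' : ∀ M : ℕ → ℕ, (∀ b : ℕ, ∀ᶠ N : ℕ in atTop, (j + 1) * (4 * (Nat.log 2 N + 3)) + b ≤ M N) →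
          ∀ t : LoopSeq d, IsLoopSeq t →
            Tendsto (fun N : ℕ => R β (j + 1) (box d (M N)) N t) atTop (𝓝 (F (j + 1) β t)) :=
        fun M hM t ht => hC1 M (adm_mono hM) t ht
      have hout := hierarchy_out (β := β) (K := K) (B := B) (j + 1) (hK4 _) (hB0 _) hθ' (hU (j + 1) β (hβ.trans hu1))
        (R β) (fun ℓ => F ℓ β) (hF β) _ hnil'' hAPQ' hEQ' hC1' hC0'
      exact ⟨hAPQ', hAPP', hEQ', hC1', hC0', hnil'', hout⟩
  obtain ⟨-, -, -, -, -, -, hCQ, hFnil, hFB, hFEQ⟩ := main k hβk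
  refine ⟨hFnil, fun s hs => (hFB s hs).trans
    (mul_le_mul_of_nonneg_left (weight_le_pow (by linarith [hK4 k]) s) (hB0 k)), hFEQ, fun M hM s hs => ?_⟩
  -- ### the closed form of the remainders and the convergence
  have hclosed : ∀ (j : ℕ) (Λ : Finset (Site d)) (N : ℕ), 1 ≤ N → ∀ u : LoopSeq d,
      R β (j + 2) Λ N u = (N : ℝ) ^ j * (phi N β Λ u - ∑ i ∈ Finset.range j, F (i + 2) β u / (N : ℝ) ^ i) := by
    intro j
    induction j with
    | zero => intro Λ N _ u; simp [hR2]
    | succ j ih =>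
      intro Λ N hN u
      have hN0 : (N : ℝ) ≠ 0 := by exact_mod_cast (by omega : N ≠ 0)
      have hmax : ((max N 1 : ℕ) : ℝ) = N := by rw [max_eq_left hN]
      rw [show j + 1 + 2 = (j + 2) + 1 by ring, hrec', hmax, ih Λ N hN u, Finset.sum_range_succ]
      field_simp
      ring
  have hconv := hCQ M (adm_of_superlog hM k) s hs
  refine hconv.congr' ?_
  filter_upwards [eventually_ge_atTop 1] with N hN
  exact hclosed k (box d (M N)) N hN s

/-- ★★★ **The `1/N` expansion, remainder form** (Chatterjee–Jafarov, Theorem 3.1 (ii) verbatim shape): with `β₀`, `F` as in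
`oneOverN_expansion`, for every `k`, `|β| ≤ β₀(d,k)`, every super-logarithmically growing sequence of cubes and every loop sequence
`s` in minimal representation, `N^k (⟨W_{l₁}⋯W_{lₙ}⟩_{Λ_N,N,β}/Nⁿ − f_0(s) − f_1(s)/N − ⋯ − f_k(s)/N^k) → 0`.
[cite: ChatterjeeJafarov2016OneOverN, Theorem 3.1 (ii)] -/
theorem oneOverN_expansion_remainder (hd : 2 ≤ d) :
    ∃ β₀ : ℕ → ℝ, (∀ k, 0 < β₀ k) ∧ ∃ F : ℕ → ℝ → LoopSeq d → ℝ,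
      ∀ (k : ℕ) (β : ℝ), |β| ≤ β₀ k →
        ∀ M : ℕ → ℕ, (∀ a : ℕ, ∀ᶠ N : ℕ in atTop, a * Nat.log 2 N ≤ M N) → ∀ s : LoopSeq d, IsLoopSeq s →
          Tendsto (fun N : ℕ => (N : ℝ) ^ k *
            (phi N β (box d (M N)) s - ∑ i ∈ Finset.range (k + 1), F (i + 2) β s / (N : ℝ) ^ i)) atTop (𝓝 0) := by
  obtain ⟨β₀, hpos, -, C, L, F, -, -, H⟩ := oneOverN_expansion d hd
  refine ⟨β₀, hpos, F, fun k β hβ M hM s hs => ?_⟩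
  have h := (H k β hβ).2.2.2 M hM s hs
  have h2 : Tendsto (fun N : ℕ => (N : ℝ) ^ k *
      (phi N β (box d (M N)) s - ∑ i ∈ Finset.range k, F (i + 2) β s / (N : ℝ) ^ i) - F (k + 2) β s) atTop (𝓝 0) := by
    simpa only [sub_self] using h.sub_const (F (k + 2) β s)
  refine h2.congr' ?_
  filter_upwards [eventually_ge_atTop 1] with N hN
  have hN0 : (N : ℝ) ≠ 0 := by exact_mod_cast (by omega : N ≠ 0)
  rw [Finset.sum_range_succ]
  field_simp
  ring

end StringDuality

end Summit.QuantumFields.GaugeBoot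

end
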